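import Summits.BirchSwinnertonDyer.BirchSwinnertonDyer.Theorems.EisensteinPrimesAnomalousTowerTorsionFinite
import Summits.BirchSwinnertonDyer.BirchSwinnertonDyer.Theorems.CumulativeHeegnerLeopoldtCumulativeHeegnerInclusionAtThreeLineBaseChange
import Summits.BirchSwinnertonDyer.BirchSwinnertonDyer.Theorems.EisensteinPrimesRamifiedCharNoLocalFixed
import Summits.BirchSwinnertonDyer.Rank1Residual.X2.ResidualDevissageModules
import Literature.NumberTheory.GaloisRepresentations.FrobeniusGeneration
import Literature.NumberTheory.EllipticCurves.GeomReductionFrobeniusProofs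
import HarnessLib

/-!
# Route `EisensteinPrimes`, crux 2 `GoodLatticeBDPValue` (stmt-BirchSwinnertonDyer-19032), line `halves` v20, stub
# `stub_indexInputs`: **the decomposition group at the good ANOMALOUS place `v̄` acts TRIVIALLY on `E_K[p]/Φ`**
# (`𝟙̃|_{G_v̄} = 𝟙` including Frobenius) — the local `H⁰` conjunct `htrivD` of the V21 index road, and
# `θquot|_{D_v̄} = 1` for the Teichmüller quotient character

Cell `bsd-eis` (home `run/shared/lean/pub/bsd-eis/`), width seat `bsd-line-x1-p1-w6` («width 6»; `--supports -19032`,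
closes nothing). Keller–Yin arXiv:2402.12781v2 §1.4 (TeX L1063–1087, display (char to f)) and Prop. 1.3.1: at a good
anomalous Eisenstein prime `p` (`a_p ≡ 1 (mod p)`, the rational `p`-line `Φ` ramified at `p`) the residual pair
`0 → 𝔽(ω̃) → E[p] → 𝔽(𝟙̃) → 0` has `ω̃|_{G_p} = ω` and `𝟙̃|_{G_p} = 𝟙` — the quotient character is TRIVIAL on the
whole decomposition group at `p`, Frobenius included («`a_p ≡ 1`» = «Frobenius acts trivially on `Ẽ[p]`», Mazur
1972 §5, Serre 1972 §1.11 (1)). In the LEAD's v20 skeleton (`Cruxes/GoodLatticeBDPValue/Lines/halves.lean`, stub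
`stub_indexInputs`) this is the local `H⁰` conjunct `htrivD : ∀ (g : ker κ ⊓ D_v̄) (n : Φ.Quot), g • n = n`, consumed by
`ResidualIndexAssembly.zpCorank_datumStrictSelmer_add_eq` (step (5): `N_1^{G_j} = 𝔽`), and behind step (8)
(`A_1^{I_j} = F/𝒪` with trivial `G_j/I_j`-action). This file proves it on exactly the crux binders, for EVERY
`Γ_K`-stable line `Φ ≤ E_K[p]` (packaged as a `StableSubgroup` with `#Φ.Sub = p`, the shape of
`ResidualPairStableLine.exists_stableLine_of_isResidualPairOver`) and for the FULL decomposition group `D_v̄`: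

* §1 (over `ℚ`) `smul_sub_mem_rationalLine_of_mem_decompositionSubgroup` — `E = W/ℚ` globally minimal, `p ∤ Δ`,
  `p ∤ a_p`, `p ∣ a_p − 1`, `Φ₀` the rational `p`-line NOT unramified at `p`: for EVERY prime `𝔓` of `\bar ℤ` above `p`
  and every `d ∈ D_𝔓`, `d • P − P ∈ Φ₀` for all `P ∈ E[p]`. At the place's prime `𝔓₀`: `d = φⁿ · i · u` (Frobenius
  generation `exists_eq_frobenius_pow_mul_of_mem_decompositionSubgroup`, `u` in the open pointwise stabiliser of `E[p]`),
  `red ∘ i = red` (`geomReduction_smul_of_mem_inertia`), `red ∘ φ = red` on `E[p]` (anomalous: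
  `geomReduction_smul_eq_self_of_dvd_frobeniusTrace_sub_one`), so `red (d • P − P) = 0` and the kernel of reduction
  on `E[p]` is `Φ₀` (`mem_rationalLine_of_geomReduction_eq_zero`, w2 gen 3); a general `𝔓 = ρ • 𝔓₀` by conjugation.
* §2 (over `K`) `smul_sub_mem_of_mem_decomp`, **`smul_quot_eq_of_mem_decomp`** — `K` imaginary quadratic, `p = v v̄`
  split, `Φ : StableSubgroup Γ_K E_K[p]` with `#Φ.Sub = p`: every `g ∈ D_v̄ = GreenbergSelmer.decomp v̄` acts
  trivially on `Φ.Quot = E_K[p]/Φ` (pull `Φ` back along `t : E[p](ℚ̄) ≃ E_K[p](K̄)` to a `Γ_K`-stable, hence rational,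
  line — `isRationalLine_of_forall_restrict_smul_mem` —, and `res(D_v̄) ≤ D_𝔔` for the contraction `𝔔` of `𝔓_{v̄}`,
  `comap_decompositionSubgroup_comap_absIntegersMap`); the v20 conjunct **`smul_quot_eq_of_mem_kerSubgroup_inf_decomp`**
  (`htrivD`, any `H ⊓ D_v̄`).
* §3 `unitChar_eq_one_of_mem_decomp`, `apply_eq_one_of_mem_decomp`, `smul_charModule_eq_of_mem_decomp` — with an
  equivariant embedding `j : Φ.Quot ↪ (F/𝒪)(θ)` of a Teichmüller character `θ` (`θ^{p−1} = 1`): `θ(g) = 1` and `g` acts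
  trivially on `(F/𝒪)(θ)` for every `g ∈ D_v̄` (`𝟙̃|_{G_v̄} = 𝟙`: KY Prop. 1.3.1 / §1.4; the input of step (8)).

HONEST FRAMING: helper theorems only (0 definitions, 0 named facts, 0 sorry); no summit statement, no BSD / IMC2 / KY
Thm 1.4.1 (iii) is proved; 0 stubs / cells / labels move. References: [KellerYin2024] Prop. 1.3.1, §1.4 (arXiv:2402.12781v2
TeX L877, L1063–1087); [Serre1972] §1.11 (1), Prop. 11; [Mazur1972] §5; [NeukirchANT1999] I §9 (9.4)–(9.6).
-/

set_option autoImplicit false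
-- the route's Theorems namespace repeats the summit name by design (D-0017 nested layout)
set_option linter.dupNamespace false

noncomputable section

open scoped Classical Pointwise

namespace Summit.BirchSwinnertonDyer.BirchSwinnertonDyer.Theorems.IndexInputsH0

open NumberField IsDedekindDomain Field WeierstrassCurve Rat.HeightOneSpectrum
  Literature.NumberTheory.EllipticCurves Literature.NumberTheory.EllipticCurves.GreenbergSelmer
  Literature.NumberTheory.EllipticCurves.Rank1Residual Literature.NumberTheory.GaloisRepresentations
  Literature.NumberTheory.EllipticCurves.KellerYin2024
  Summit.BirchSwinnertonDyer.Rank1Residual.X2.ResidualDevissageModules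
  Summit.BirchSwinnertonDyer.BirchSwinnertonDyer.Theorems.AnomalousLocalTorsion
  Summit.BirchSwinnertonDyer.BirchSwinnertonDyer.Theorems.CumulativeHeegnerInclusionAtThreeLineBaseChange

/-! ## §1. Over `ℚ`: `D_𝔓` acts trivially on `E[p]/Φ₀` at an anomalous prime -/

section RatSide

variable {W : WeierstrassCurve ℚ} [W.IsElliptic] [W.IsGloballyMinimal] {p : ℕ} [hp : Fact p.Prime]

/-- **`d • P − P ∈ Φ₀` for every `d` in the decomposition group of the place's prime `𝔓₀` and every `P ∈ E[p]`**, at a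
good ordinary prime with `a_p ≡ 1 (mod p)` and `Φ₀` the rational `p`-line not unramified at `p`: Frobenius generation
`d = φⁿ · i · u`, reduction is unchanged by inertia and — anomalously — by Frobenius on `E[p]`, and the kernel of reduction
on `E[p]` is `Φ₀`. [cite: Serre1972, §1.11 (1) and Prop. 11] [cite: Mazur1972, §5 (anomalous primes)]
[cite: NeukirchANT1999, Ch. I §9 Prop. (9.4)] -/
theorem smul_sub_mem_rationalLine_of_mem_decompositionSubgroup_placeOver
    (hΔ : ¬ (p : ℤ) ∣ minimalDiscriminantInt W) (hord : ¬ (p : ℤ) ∣ W.frobeniusTrace p)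
    (ha : (p : ℤ) ∣ W.frobeniusTrace p - 1) {𝔓 : Ideal (absIntegers (𝓞 ℚ) ℚ)}
    (hmem : ∀ x : absIntegers (𝓞 ℚ) ℚ, x ∈ 𝔓 ↔ (x : AlgebraicClosure ℚ) ∈ (placeOver p).nonunits)
    {v : HeightOneSpectrum (𝓞 ℚ)} (hv : (primesEquiv v : ℕ) = p) (hu : (p : 𝓞 ℚ) ∈ v.asIdeal)
    (h𝔓 : 𝔓 ∈ v.primesAbove)
    {Φ₀ : AddSubgroup (geomTorsion W (p : ℤ))} (hΦ₀ : IsRationalLine W p Φ₀) (hram : ¬ LineUnramifiedAt W p Φ₀)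
    {d : absoluteGaloisGroup ℚ} (hd : d ∈ 𝔓.decompositionSubgroup (absoluteGaloisGroup ℚ))
    (P : geomTorsion W (p : ℤ)) : d • P - P ∈ Φ₀ := by
  obtain ⟨φ, hφ⟩ := HeightOneSpectrum.exists_isArithFrobAt_of_mem_primesAbove_holds h𝔓
  obtain ⟨n, i, u, hi, hu', rfl⟩ := exists_eq_frobenius_pow_mul_of_mem_decompositionSubgroup h𝔓 hφ
    (isOpen_iInf_stabilizer_geomTorsion W p) hd
  have huP : u • P = P := by
    have h : u • (P : W.geomPoints) = P := (Subgroup.mem_iInf.mp hu') P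
    exact Subtype.ext (by rw [AddSubgroup.torsionBy.coe_smul]; exact h)
  have hpt : ∀ Q : geomTorsion W (p : ℤ), (p : ℤ) • (Q : W.geomPoints) = 0 := fun Q ↦
    (Submodule.mem_torsionBy_iff _ _).mp Q.2
  have hφk : ∀ (k : ℕ) (Q : geomTorsion W (p : ℤ)),
      geomReduction hΔ ((φ ^ k • Q : geomTorsion W (p : ℤ)) : W.geomPoints) =
        geomReduction hΔ (Q : W.geomPoints) := by
    intro k
    induction k with
    | zero => intro Q; rw [pow_zero, one_smul]
    | succ k ih =>
      intro Q
      rw [pow_succ, mul_smul, ih, AddSubgroup.torsionBy.coe_smul,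
        geomReduction_smul_eq_self_of_dvd_frobeniusTrace_sub_one hΔ hmem hv h𝔓 hφ ha _ (hpt Q)]
  have hred : geomReduction hΔ (((φ ^ n * i * u) • P - P : geomTorsion W (p : ℤ)) : W.geomPoints) = 0 := by
    rw [AddSubgroupClass.coe_sub, map_sub, mul_smul, mul_smul, huP, hφk n, AddSubgroup.torsionBy.coe_smul,
      geomReduction_smul_of_mem_inertia hΔ hmem hi, sub_self]
  exact mem_rationalLine_of_geomReduction_eq_zero hΔ hord hmem hu h𝔓 hΦ₀ hram hred

/-- **The same at EVERY prime `𝔓` of `\bar ℤ` above `p`** (conjugate `𝔓 = ρ • 𝔓₀`, `D_𝔓 = ρ D_{𝔓₀} ρ⁻¹`, `Φ₀` is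
`Γ_ℚ`-stable): at a good ordinary anomalous prime, every `d ∈ D_𝔓` satisfies `d • P − P ∈ Φ₀` for all `P ∈ E[p]` — the
decomposition group acts TRIVIALLY on `E[p]/Φ₀` («`ψ|_{G_p} = 𝟙`»). [cite: KellerYin2024, Prop. 1.3.1 and §1.4 (arXiv:2402.12781v2 TeX L877, L1063–1087)]
[cite: Serre1972, §1.11 (1)] -/
theorem smul_sub_mem_rationalLine_of_mem_decompositionSubgroup
    (hΔ : ¬ (p : ℤ) ∣ minimalDiscriminantInt W) (hord : ¬ (p : ℤ) ∣ W.frobeniusTrace p)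
    (ha : (p : ℤ) ∣ W.frobeniusTrace p - 1)
    {v : HeightOneSpectrum (𝓞 ℚ)} (hu : (p : 𝓞 ℚ) ∈ v.asIdeal)
    {Φ₀ : AddSubgroup (geomTorsion W (p : ℤ))} (hΦ₀ : IsRationalLine W p Φ₀) (hram : ¬ LineUnramifiedAt W p Φ₀)
    {𝔓 : Ideal (absIntegers (𝓞 ℚ) ℚ)} (h𝔓 : 𝔓 ∈ v.primesAbove)
    {d : absoluteGaloisGroup ℚ} (hd : d ∈ 𝔓.decompositionSubgroup (absoluteGaloisGroup ℚ))
    (P : geomTorsion W (p : ℤ)) : d • P - P ∈ Φ₀ := by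
  have hv : (primesEquiv v : ℕ) = p := Literature.NumberTheory.EllipticCurves.primesEquiv_eq_of_natCast_mem hp.out hu
  obtain ⟨𝔓₀, hmem, h𝔓₀⟩ := exists_ideal_placeOver p hv
  obtain ⟨ρ, hρ⟩ := HeightOneSpectrum.exists_smul_eq_of_mem_primesAbove_holds (K := ℚ) (v := v) h𝔓 h𝔓₀
  -- `ρ d ρ⁻¹ ∈ D_{𝔓₀}`
  have hd' : ρ * d * ρ⁻¹ ∈ 𝔓₀.decompositionSubgroup (absoluteGaloisGroup ℚ) := by
    rw [← hρ, Ideal.decompositionSubgroup_smul]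
    exact ⟨d, hd, rfl⟩
  have h := smul_sub_mem_rationalLine_of_mem_decompositionSubgroup_placeOver hΔ hord ha hmem hv hu h𝔓₀ hΦ₀ hram
    hd' (ρ • P)
  rw [mul_smul, mul_smul, inv_smul_smul, ← smul_sub] at h
  have h' := hΦ₀.2 ρ⁻¹ _ h
  rwa [inv_smul_smul] at h'

end RatSide

/-! ## §2. Over `K`: `D_v̄` acts trivially on `E_K[p]/Φ` -/

section KSide

variable (W : WeierstrassCurve ℚ) [W.IsElliptic] [W.IsGloballyMinimal] {p : ℕ} [hp : Fact p.Prime]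
  {K : Type} [Field K] [NumberField K]

/-- **`g • Q − Q ∈ Φ` for every `g ∈ D_v̄` and `Q ∈ E_K[p]`**, on the binders of crux 2 (`p` odd, `Anom W p`, no unramified
rational `p`-line, `K` imaginary quadratic with `p = v v̄` split) and for every `Γ_K`-stable line `Φ ≤ E_K[p]` of order `p`:
pull `Φ` back along the equivariant `t : E[p](ℚ̄) ≃ E_K[p](K̄)` to a rational line (`isRationalLine_of_forall_restrict_smul_mem`)
and restrict `D_v̄` into the decomposition group of the contraction of `𝔓_{v̄}` (§1).
[cite: KellerYin2024, Prop. 1.3.1 and §1.4 (arXiv:2402.12781v2 TeX L877, L1063–1087)] [cite: NeukirchANT1999, Ch. I §9 (9.4)–(9.6)] -/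
theorem smul_sub_mem_of_mem_decomp (hp2 : p ≠ 2) (hanom : Anom W p)
    (hGL : ∀ Φ : AddSubgroup (geomTorsion W (p : ℤ)), IsRationalLine W p Φ → ¬ LineUnramifiedAt W p Φ)
    (hK : IsImaginaryQuadratic K) {v vbar : HeightOneSpectrum (𝓞 K)} (hpv : ((p : ℕ) : 𝓞 K) ∈ v.asIdeal)
    (hpvbar : ((p : ℕ) : 𝓞 K) ∈ vbar.asIdeal) (hne : vbar ≠ v)
    {Φ : AddSubgroup ((W.baseChange K).geomTorsion (p : ℤ))} (hΦ : Nat.card Φ = p)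
    (hstab : ∀ (σ : absoluteGaloisGroup K), ∀ Q ∈ Φ, σ • Q ∈ Φ)
    {g : absoluteGaloisGroup K} (hg : g ∈ GreenbergSelmer.decomp vbar)
    (Q : (W.baseChange K).geomTorsion (p : ℤ)) : g • Q - Q ∈ Φ := by
  have hpr : p.Prime := hp.out
  have _hv := hpv; have _hne := hne
  -- good ordinary anomalous
  have hΔ : ¬ (p : ℤ) ∣ minimalDiscriminantInt W := W.not_dvd_minimalDiscriminantInt_of_hasGoodReductionAtPrime' p hanom.2.1
  have hord : ¬ (p : ℤ) ∣ W.frobeniusTrace p := by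
    intro h
    have h1 : (p : ℤ) ∣ 1 := by
      have := dvd_sub h hanom.2.2
      rwa [sub_sub_cancel] at this
    exact hpr.one_lt.ne' (by exact_mod_cast Int.eq_one_of_dvd_one (Int.natCast_nonneg p) h1)
  -- the rational line `Ψ = t⁻¹ Φ`
  obtain ⟨t, ht⟩ := exists_geomTorsion_baseChange_equiv W K (p : ℤ)
  have ht' : ∀ (σ : absoluteGaloisGroup K) (P : W.geomTorsion (p : ℤ)),
      t (absGaloisRestrict ℚ K σ • P) = σ • t P := fun σ P ↦ by
    rw [← resGal_eq_absGaloisRestrict]; exact ht σ P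
  have hsymm : ∀ (σ : absoluteGaloisGroup K) (Q : (W.baseChange K).geomTorsion (p : ℤ)),
      t.symm (σ • Q) = absGaloisRestrict ℚ K σ • t.symm Q := fun σ Q ↦ by
    apply t.injective; rw [t.apply_symm_apply, ht', t.apply_symm_apply]
  set Ψ : AddSubgroup (W.geomTorsion (p : ℤ)) := Φ.comap t.toAddMonoidHom with hΨ
  have hmemΨ : ∀ P, P ∈ Ψ ↔ t P ∈ Φ := fun _ ↦ Iff.rfl
  have hΨcard : Nat.card Ψ = p :=
    (Nat.card_congr
      { toFun := fun x ↦ ⟨t x.1, x.2⟩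
        invFun := fun Q ↦ ⟨t.symm Q.1, show t (t.symm Q.1) ∈ Φ by rw [t.apply_symm_apply]; exact Q.2⟩
        left_inv := fun x ↦ Subtype.ext (t.symm_apply_apply x.1)
        right_inv := fun Q ↦ Subtype.ext (t.apply_symm_apply Q.1) : Ψ ≃ Φ }).trans hΦ
  have hstabΨ : ∀ (τ : absoluteGaloisGroup K), ∀ P ∈ Ψ, absGaloisRestrict ℚ K τ • P ∈ Ψ := by
    intro τ P hP
    rw [hmemΨ] at hP ⊢
    rw [ht']
    exact hstab τ _ hP
  have hrat : IsRationalLine W p Ψ :=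
    ResidualLineRigidity.isRationalLine_of_forall_restrict_smul_mem hp2 hanom hGL hK hΨcard hstabΨ
  have hram : ¬ LineUnramifiedAt W p Ψ := hGL Ψ hrat
  -- the place `u` of `ℚ` below `v̄` and the contraction `𝔔` of `𝔓_{v̄}`
  set u : HeightOneSpectrum (𝓞 ℚ) := vbar.under (𝓞 ℚ) with hudef
  have hu : (p : 𝓞 ℚ) ∈ u.asIdeal := natCast_mem_under_rat (K := K) hpvbar
  have hwu : vbar.asIdeal.under (𝓞 ℚ) = u.asIdeal := (HeightOneSpectrum.under_asIdeal (𝓞 ℚ) vbar).symm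
  set 𝔓K : Ideal (absIntegers (𝓞 K) K) := adicCompletionPrime K vbar with h𝔓K
  have h𝔔 : 𝔓K.comap (absIntegersMap ℚ K) ∈ u.primesAbove :=
    comap_absIntegersMap_mem_primesAbove hwu (adicCompletionPrime_mem_primesAbove K vbar)
  -- `res g ∈ D_𝔔`
  have hgD : absGaloisRestrict ℚ K g ∈ (𝔓K.comap (absIntegersMap ℚ K)).decompositionSubgroup (absoluteGaloisGroup ℚ) := by
    have h : g ∈ 𝔓K.decompositionSubgroup (absoluteGaloisGroup K) := by
      rw [h𝔓K, decompositionSubgroup_adicCompletionPrime_eq_range]; exact hg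
    rw [← comap_decompositionSubgroup_comap_absIntegersMap ℚ K 𝔓K] at h
    exact h
  -- conclude through `t`
  have h := smul_sub_mem_rationalLine_of_mem_decompositionSubgroup hΔ hord hanom.2.2 hu hrat hram h𝔔 hgD (t.symm Q)
  rw [hmemΨ, map_sub, ← hsymm, t.apply_symm_apply, t.apply_symm_apply] at h
  exact h

/-- **`D_v̄` acts TRIVIALLY on `Φ.Quot = E_K[p]/Φ`** for every `Γ_K`-stable line `Φ` (as a `StableSubgroup`, `#Φ.Sub = p`),
on the binders of crux 2: `𝟙̃|_{G_v̄} = 𝟙`, Frobenius included. [cite: KellerYin2024, Prop. 1.3.1 and §1.4 (arXiv:2402.12781v2 TeX L877, L1063–1087)]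
[cite: Mazur1972, §5] -/
theorem smul_quot_eq_of_mem_decomp (hp2 : p ≠ 2) (hanom : Anom W p)
    (hGL : ∀ Φ : AddSubgroup (geomTorsion W (p : ℤ)), IsRationalLine W p Φ → ¬ LineUnramifiedAt W p Φ)
    (hK : IsImaginaryQuadratic K) {v vbar : HeightOneSpectrum (𝓞 K)} (hpv : ((p : ℕ) : 𝓞 K) ∈ v.asIdeal)
    (hpvbar : ((p : ℕ) : 𝓞 K) ∈ vbar.asIdeal) (hne : vbar ≠ v)
    (Φ : StableSubgroup (absoluteGaloisGroup K) ↥((W.baseChange K).geomTorsion (p : ℤ))) (hΦ : Nat.card Φ.Sub = p)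
    {g : absoluteGaloisGroup K} (hg : g ∈ GreenbergSelmer.decomp vbar) (y : Φ.Quot) : g • y = y :=
  (Φ.forall_smul_quot_eq_self_iff g).mpr
    (fun Q ↦ smul_sub_mem_of_mem_decomp W hp2 hanom hGL hK hpv hpvbar hne (Φ := Φ.toAddSubgroup) hΦ
      (fun σ _ hQ ↦ Φ.smul_mem' σ hQ) hg Q) y

/-- **The v20 conjunct `htrivD` of `stub_indexInputs`**: `H ⊓ D_v̄` (any `H ≤ Γ_K`, e.g. `H = ker κ`) acts trivially on `Φ.Quot`,
in the `Subgroup`-action shape consumed by `ResidualIndexAssembly.zpCorank_datumStrictSelmer_add_eq`.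
[cite: KellerYin2024, §1.4 Cases I–III (arXiv:2402.12781v2 TeX L1178–1330)] -/
theorem smul_quot_eq_of_mem_inf_decomp (hp2 : p ≠ 2) (hanom : Anom W p)
    (hGL : ∀ Φ : AddSubgroup (geomTorsion W (p : ℤ)), IsRationalLine W p Φ → ¬ LineUnramifiedAt W p Φ)
    (hK : IsImaginaryQuadratic K) {v vbar : HeightOneSpectrum (𝓞 K)} (hpv : ((p : ℕ) : 𝓞 K) ∈ v.asIdeal)
    (hpvbar : ((p : ℕ) : 𝓞 K) ∈ vbar.asIdeal) (hne : vbar ≠ v) (H : Subgroup (absoluteGaloisGroup K))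
    (Φ : StableSubgroup (absoluteGaloisGroup K) ↥((W.baseChange K).geomTorsion (p : ℤ))) (hΦ : Nat.card Φ.Sub = p)
    (g : ↥(H ⊓ GreenbergSelmer.decomp vbar)) (y : Φ.Quot) : g • y = y := by
  rw [Subgroup.smul_def]
  exact smul_quot_eq_of_mem_decomp W hp2 hanom hGL hK hpv hpvbar hne Φ hΦ (Subgroup.mem_inf.mp g.2).2 y

end KSide

/-! ## §3. The quotient character: `θquot(g) = 1` on `D_v̄` -/

section Char

variable (W : WeierstrassCurve ℚ) [W.IsElliptic] [W.IsGloballyMinimal] {p : ℕ} [hp : Fact p.Prime]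
  {K : Type} [Field K] [NumberField K]
  (θ : FramedGaloisRep K (padicCoeffIntegers (∅ : Set (PadicAlgCl p))) 1)

/-- **`unitChar θ g = 1` for every `g ∈ D_v̄`** when `θ` is a Teichmüller character (`θ^{p−1} = 1`) receiving an equivariant
embedding `j : Φ.Quot ↪ (F/𝒪)(θ)` of the quotient of a `Γ_K`-stable `p`-line of `E_K[p]` (the residual pair's `θquot = 𝟙̃`):
`g` fixes the non-zero vector `j(y₀)`, and a Teichmüller unit `≠ 1` fixes nothing (`CharResidualSelmerCount.eq_zero_of_smul_eq_of_hom`).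
[cite: KellerYin2024, Prop. 1.3.1 and §1.4 display (char to f) (arXiv:2402.12781v2 TeX L877, L1063–1087)] -/
theorem unitChar_eq_one_of_mem_decomp (hp2 : p ≠ 2) (hanom : Anom W p)
    (hGL : ∀ Φ : AddSubgroup (geomTorsion W (p : ℤ)), IsRationalLine W p Φ → ¬ LineUnramifiedAt W p Φ)
    (hK : IsImaginaryQuadratic K) {v vbar : HeightOneSpectrum (𝓞 K)} (hpv : ((p : ℕ) : 𝓞 K) ∈ v.asIdeal)
    (hpvbar : ((p : ℕ) : 𝓞 K) ∈ vbar.asIdeal) (hne : vbar ≠ v)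
    (Φ : StableSubgroup (absoluteGaloisGroup K) ↥((W.baseChange K).geomTorsion (p : ℤ))) (hΦ : Nat.card Φ.Sub = p)
    (hθ : ∀ σ : absoluteGaloisGroup K, θ σ ^ (p - 1) = 1)
    (j : Φ.Quot →+ charModule (∅ : Set (PadicAlgCl p)) θ)
    (hj : ∀ (σ : absoluteGaloisGroup K) (y : Φ.Quot), j (σ • y) = σ • j y) (hinj : Function.Injective j)
    {g : absoluteGaloisGroup K} (hg : g ∈ GreenbergSelmer.decomp vbar) : unitChar θ g = 1 := by
  have hpr : p.Prime := hp.out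
  haveI hEK : (W.baseChange K).IsElliptic := inferInstanceAs (W.map (algebraMap ℚ K)).IsElliptic
  -- `Φ.Quot` has a non-zero element (order `p`)
  have hQuot : Nat.card Φ.Quot = p := by
    have h := Φ.natCard_eq_mul
    rw [(W.baseChange K).natCard_geomTorsion_prime_eq_sq hpr, hΦ, sq] at h
    exact (Nat.eq_of_mul_eq_mul_right hpr.pos h).symm
  haveI : Finite Φ.Quot := Nat.finite_of_card_ne_zero (by rw [hQuot]; exact hpr.ne_zero)
  obtain ⟨y₀, hy₀⟩ : ∃ y₀ : Φ.Quot, y₀ ≠ 0 := by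
    by_contra h
    push Not at h
    haveI : Subsingleton Φ.Quot := ⟨fun a b ↦ by rw [h a, h b]⟩
    have : Nat.card Φ.Quot = 1 := Nat.card_of_subsingleton 0
    rw [hQuot] at this
    exact hpr.one_lt.ne' this
  by_contra hne1
  exact hy₀ (CharResidualSelmerCount.eq_zero_of_smul_eq_of_hom θ hθ j hj hinj hne1
    (smul_quot_eq_of_mem_decomp W hp2 hanom hGL hK hpv hpvbar hne Φ hΦ hg y₀))

/-- **`θ(g) = 1` (as a matrix) for every `g ∈ D_v̄`**, same hypotheses: the Teichmüller quotient character of the residual pair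
is TRIVIAL on the decomposition group at the anomalous place (`𝟙̃|_{G_v̄} = 𝟙`). [cite: KellerYin2024, Prop. 1.3.1 (arXiv:2402.12781v2 TeX L877)] -/
theorem apply_eq_one_of_mem_decomp (hp2 : p ≠ 2) (hanom : Anom W p)
    (hGL : ∀ Φ : AddSubgroup (geomTorsion W (p : ℤ)), IsRationalLine W p Φ → ¬ LineUnramifiedAt W p Φ)
    (hK : IsImaginaryQuadratic K) {v vbar : HeightOneSpectrum (𝓞 K)} (hpv : ((p : ℕ) : 𝓞 K) ∈ v.asIdeal)
    (hpvbar : ((p : ℕ) : 𝓞 K) ∈ vbar.asIdeal) (hne : vbar ≠ v)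
    (Φ : StableSubgroup (absoluteGaloisGroup K) ↥((W.baseChange K).geomTorsion (p : ℤ))) (hΦ : Nat.card Φ.Sub = p)
    (hθ : ∀ σ : absoluteGaloisGroup K, θ σ ^ (p - 1) = 1)
    (j : Φ.Quot →+ charModule (∅ : Set (PadicAlgCl p)) θ)
    (hj : ∀ (σ : absoluteGaloisGroup K) (y : Φ.Quot), j (σ • y) = σ • j y) (hinj : Function.Injective j)
    {g : absoluteGaloisGroup K} (hg : g ∈ GreenbergSelmer.decomp vbar) : θ g = 1 := by
  have h := unitChar_eq_one_of_mem_decomp W θ hp2 hanom hGL hK hpv hpvbar hne Φ hΦ hθ j hj hinj hg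
  -- a `1 × 1` invertible matrix is its entry (`GreenbergFullAtSelmer.unitChar_eq_one_iff`, inlined)
  have h00 := padicIntEquiv_unitChar θ g
  rw [h, Units.val_one, map_one] at h00
  refine Units.ext (Matrix.ext fun i k ↦ ?_)
  rw [Fin.fin_one_eq_zero i, Fin.fin_one_eq_zero k, ← h00]
  simp

/-- **`D_v̄` acts trivially on `(F/𝒪)(θ)`** for the Teichmüller quotient character `θ = θquot` of the residual pair (same
hypotheses): V21 step (8), `A_1^{I_j} = A_1 = F/𝒪` with TRIVIAL action of `G_j`, whence `H¹(G_j/I_j, A_1^{I_j}) ≅ F/𝒪`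
and `λ_nr(𝟙̃) = λ_str(𝟙̃) + s`. [cite: KellerYin2024, §1.4 (arXiv:2402.12781v2 TeX L1240–1260) and Rem. 1.2.2] -/
theorem smul_charModule_eq_of_mem_decomp (hp2 : p ≠ 2) (hanom : Anom W p)
    (hGL : ∀ Φ : AddSubgroup (geomTorsion W (p : ℤ)), IsRationalLine W p Φ → ¬ LineUnramifiedAt W p Φ)
    (hK : IsImaginaryQuadratic K) {v vbar : HeightOneSpectrum (𝓞 K)} (hpv : ((p : ℕ) : 𝓞 K) ∈ v.asIdeal)
    (hpvbar : ((p : ℕ) : 𝓞 K) ∈ vbar.asIdeal) (hne : vbar ≠ v)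
    (Φ : StableSubgroup (absoluteGaloisGroup K) ↥((W.baseChange K).geomTorsion (p : ℤ))) (hΦ : Nat.card Φ.Sub = p)
    (hθ : ∀ σ : absoluteGaloisGroup K, θ σ ^ (p - 1) = 1)
    (j : Φ.Quot →+ charModule (∅ : Set (PadicAlgCl p)) θ)
    (hj : ∀ (σ : absoluteGaloisGroup K) (y : Φ.Quot), j (σ • y) = σ • j y) (hinj : Function.Injective j)
    {g : absoluteGaloisGroup K} (hg : g ∈ GreenbergSelmer.decomp vbar)
    (x : charModule (∅ : Set (PadicAlgCl p)) θ) : g • x = x := by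
  obtain ⟨z, rfl⟩ := (charModuleEquiv θ).symm.surjective x
  rw [CharResidualSelmerFinite.galois_smul_charModuleEquiv_symm,
    unitChar_eq_one_of_mem_decomp W θ hp2 hanom hGL hK hpv hpvbar hne Φ hΦ hθ j hj hinj hg, Units.val_one, one_smul]

end Char

end Summit.BirchSwinnertonDyer.BirchSwinnertonDyer.Theorems.IndexInputsH0

end
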